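import Summits.QuantumFields.YangMills.Theorems.UnitScaleTiltFluctuationComparisonRegPrRepAtHeightsWinRow
import Summits.QuantumFields.YangMills.Theorems.AlphaInputsT3ACv3StepLowPrint
import HarnessLib

/-!
# `AlphaInputsT3ACv3StepChiClash` — THE χ-CLASH: the two (O‴χₛ) residual rows of one step `k` — R3D-01 `PinnedStep.Fibre55WinAC … win k triv′` (print's (55)
# at the TRIVIAL new history) and R3D-02χ `PinnedStep.Fibre57LowOnAC … lo k` (print's (57) on a validity family `lo`, registered at `lo = PinnedStep.loPrintAC`) —
# READ ONE FLUCTUATION PIN `(𝔖 k).logFl (Hist.triv _ (k+1))` WITH NO SLACK, HENCE SQUEEZE: any joint supplier forces, for `dU`-a.e. `U` whose average lies in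
# `lo (k+1)`, «`χB_k(triv′)(U) ≠ 0 ⇒ U ∈ lo k`» — at `lo = loPrintAC` this is the (E2) letter `hdom` at window constant ONE, almost everywhere on the charged region
# (cell ym3-torus, crux stmt-QuantumFields-19936 `HistoryTailL`, (α) rows #22∕#23; seat ym-ust-19936-w8 g17; helper `--supports stmt-QuantumFields-19936`)

WHY.  The lane's `Balaban3D.Proofs.FibreClash.ae_small_of_transported_pair` recorded the same squeeze for the standard tower's pair {`Fibre49`(triv), `Fibre57Low`} and
repaired it by putting the small-field factor `χB` of (49) at the (4)∕(7) threshold `ε₁` (so that upper and lower cut-offs COINCIDE and the squeeze is the consistent pinning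
`T_k[χ_k·G] = e^{F}`).  The χ-re-cut «R-57χ» (owner RULING g23-№2) then put PRINT'S χ of (47) p.267 — the MINIMISER window `|U_k(U)(∂p) − 1| < ε₁(k)η²` at constant ONE,
`PinnedStep.loPrintAC 𝔎 X k = {(4)-window} ∩ PinnedStep.chiMinAC 𝔎 X 1 k` — INSIDE the lower row's fibre integral, while the upper row kept the `χB_k(triv′) = 𝟙[(4)-window]` cut
and the schema kept ONE `logFl` slot (`Balaban3D/Carriers/Pieces.lean` :39) with the remainders `Rm k`∕`Zterm k` entering each row with the SAME sign on both sides.  At the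
trivial history the two rows therefore read (`stepWeight_triv`, `massP_triv`, `wtP_admWindowT3_triv_eq_one`; mass-free form of the upper row =
✓`LogComparisonRepAtHeights.fibre55Triv_of_fibre55WinAC`):
  (U)  `T_k[χB_k(triv′)·e^{B + δ}](V) ≤ e^{C(V) + δ}`,            (L)  `𝟙[lo (k+1)](V)·e^{C(V)} ≤ T_k[𝟙[lo k]·e^{B}](V)`     (dV-a.e.),
with ONE `B(U) = −mainT_k(triv,U) + Pint_k(triv,U) − E_k − Rm_k`, ONE `C(V) = −mainT_{k+1}(triv′,V) − E_k + (ℓσ + d_g log g_k)·⋆B + logZU + Pold − Rm_k + logFl(triv′,V)` and the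
constant `δ = Zterm_k(triv) + 2Rm_k`.  Testing both against `𝟙[lo (k+1)](Ū)` through the push-forward identity of `T_k` (`Carriers.isRT_rnTransport_of_ac`, the input's `AvgAC`)
gives `∫ (χB_k(triv′) − 𝟙[lo k])(U)·e^{B(U)+δ}·𝟙[lo (k+1)](Ū) dU ≤ 0` with a NON-NEGATIVE integrand as soon as `lo k ⊆ {(4)-window}` (`PinnedStep.loPrintAC_subset_window`).  HENCE
(`ae_mem_lo_of_fibre55Triv_of_fibre57LowOn`): for dU-a.e. `U`, `Ū ∈ lo (k+1) → PlaqSmall ε₁(k) U → U ∈ lo k`; at `lo = loPrintAC` (`ae_hdom_one_of_rows`): for dU-a.e. `U` with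
`Ū ∈ loPrintAC (k+1)`, `PlaqSmall ε₁(k) U → U ∈ chiMinAC 𝔎 X 1 k` — the (E2) letter `hdom` («`χB_k(triv′)(U) ≠ 0 ⇒ U ∈ loPrintAC k`», displayed by every print-family lower-row
theorem of the (α)-#23 chain, e.g. ✓`…v3StepLowPrintOrbit.fibre57LowOnAC_T3_loPrintAC_of_le_gamma_of_orbit` :140) almost everywhere on the fibres over print's family.
WHAT THIS MEANS FOR THE CELL (recorded, not decided here): (i) re-routing the lower row (RC-B) cannot retire `hdom`@1 while the upper row keeps the `χB` cut and the schema has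
one `logFl` slot — a.e.-`hdom`@1 is a COROLLARY of any joint supplier; (ii) [Balaban1985Variational] Thm 1 (8) gives the minimiser window at constant `2L²B₃`, not `1`, and the
linearised variational problem overshoots block means by `√3` per direction (seat memo `FINDING-CHI-CLASH-w8g17.md`, toy computation) — so a.e.-`hdom`@1 is expected to FAIL on a
set of positive Haar measure, i.e. the registered pair is expected to be jointly unsatisfiable at honest minimiser data (vacuity class; evidence, NOT a kernel refutation);
(iii) print bounds the (49)∕(55) and the (47)∕(57) fluctuation integrals SEPARATELY — a print-faithful schema carries two fluctuation slots or a slack letter in the lower row.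
HONEST SCOPE.  [folklore] measure theory about DISPLAYED rows (an implication between hypotheses); nothing of [Balaban1985UV3] is asserted or refuted by kernel; `hdom`, the pins,
(O‴χₛ) `stub_selXsV4DataRows`, `HistoryTailL` (19936), EX, 20520 are NOT proved; the registry is untouched; def-free; count-neutral helper.  Rung R3 bookkeeping; not d = 4, not
a mass gap, not Clay; the Yang–Mills mass gap is NOT proved.
References: T. Bałaban, Commun. Math. Phys. 102 (1985) 255–275 [Balaban1985UV3] ((7) p.257, (41) p.266, (47) p.267, (49)–(55) pp.268–269, (57)–(58) p.270, p.272 L32–33);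
Commun. Math. Phys. 102 (1985) 277–309 [Balaban1985Variational] (Thm 1 (8) p.279).
-/

set_option autoImplicit false

noncomputable section

namespace Summit.QuantumFields.YangMills.Theorems.PinnedStepChiClash

open MeasureTheory
open Literature.MathematicalPhysics.QuantumFieldTheory.Balaban1983to89
open Literature.MathematicalPhysics.QuantumFieldTheory.Balaban1983to89.AveragingRT (rnTransport rnTransport_nonneg)
open Literature.MathematicalPhysics.QuantumFieldTheory.Balaban1985CMP102
open Literature.MathematicalPhysics.QuantumFieldTheory.Balaban1985CMP102.Setting
open Summit.QuantumFields.Balaban3D.Carriers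
open Summit.QuantumFields.Balaban3D.Proofs.Inputs (LaneConsts)
open Summit.QuantumFields.Balaban3D.Proofs.TowerAC
open Summit.QuantumFields.Balaban3D.Proofs.StandardAC
open Summit.QuantumFields.Balaban3D.Proofs.InputsAC
open Summit.QuantumFields.Balaban3D.Proofs.Bound55Masses (chiB chiB_nonneg chiB_le_one measurable_chiB)
open Summit.QuantumFields.Balaban3D.Proofs.MassesPAC
open Summit.QuantumFields.Balaban3D.Proofs (Bound55Std.measurable_actionEta Bound55Std.actionEta_nonneg)
open Summit.QuantumFields.YangMills.Theorems.PinnedStep (massP wtP Fibre55WinAC Fibre57LowOnAC chiMinAC loPrintAC loPrintAC_subset_window)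

variable {L : ℕ} (𝔎 : LaneConsts L) {S : Scales L} {G : Type} [GaugeGroup G] [MeasurableSpace G] [HaarData G] [RegularGaugeGroup G]
  {E : Type} [NormedAddCommGroup E] [NormedSpace ℂ E]
  (X : ExternalInputsAC S G) (𝔖 : ∀ k, StepSeries S G E (nblkOf S 𝔎.carrier k) k)

/-! ## §1 The squeeze: mass-free trivial-history upper row ∧ lower row on `lo` ⇒ «(4)-window ⊆ lo k» a.e. on the fibres over `lo (k+1)` -/

/-- **THE χ-CLASH SQUEEZE (lane-generic, any gauge group, any AC averaging, any validity family `lo` inside the (4)-window).**  If the MASS-FREE TRIVIAL-HISTORY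
UPPER ROW (the text of ✓`LogComparisonRepAtHeights.fibre55Triv_of_fibre55WinAC`'s conclusion: `T_k[χB_k(triv′)·e^{(41)_k-exponent}] ≤ᵐ e^{(55)·(58)-exponent at triv′}`) and the
LOWER ROW `PinnedStep.Fibre57LowOnAC 𝔎 X 𝔖 lo k` hold for the SAME pieces `𝔖` (one `logFl(triv′,·)` on both right-hand sides), with `lo k ⊆ {(4)-window of level k}` and the
primitive regularity of the trivial-history data (`U_k(·,triv)` measurable, `Pint_k(triv,·)` measurable and bounded above), THEN for `dU`-a.e. `U`:
`Ū ∈ lo (k+1) → |U(∂p) − 1| < ε₁(k) ∀p → U ∈ lo k`.  Proof: `FibreClash.ae_small_of_transported_pair`'s squeeze, tested against `𝟙[lo (k+1)](Ū)`. [folklore] -/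
theorem ae_mem_lo_of_fibre55Triv_of_fibre57LowOn (lo : (k : ℕ) → Set (GaugeField S.P k G)) (k : ℕ)
    (hlom : MeasurableSet (lo k)) (hlom' : MeasurableSet (lo (k + 1)))
    (hlow : lo k ⊆ {U | PlaqSmall (eps1Of S 𝔎.carrier k) U})
    (hU : Measurable (X.UkH k (Hist.triv S.P k))) (hPm : Measurable ((inputOfAC 𝔎 X 𝔖).Pint k (Hist.triv S.P k)))
    (cP : ℝ) (hPb : ∀ U, (inputOfAC 𝔎 X 𝔖).Pint k (Hist.triv S.P k) U ≤ cP)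
    (h55 : (rnTransport (X.av k).avg (fun U =>
        chiB 𝔎.carrier.M₁ (rcolOf S 𝔎.carrier) (eps1Of S 𝔎.carrier) k (Hist.triv S.P (k + 1)) U *
          Real.exp (-((towerOfAC 𝔎 X 𝔖).mainT k (Hist.triv S.P k) U) + (towerOfAC 𝔎 X 𝔖).Pint k (Hist.triv S.P k) U - (towerOfAC 𝔎 X 𝔖).Ecst k
            + (towerOfAC 𝔎 X 𝔖).Zterm k (Hist.triv S.P k) + (towerOfAC 𝔎 X 𝔖).Rm k)))
      ≤ᵐ[fieldMeasure S.P (k + 1) G] fun V =>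
        Real.exp (-((towerOfAC 𝔎 X 𝔖).mainT (k + 1) (Hist.triv S.P (k + 1)) V) - (towerOfAC 𝔎 X 𝔖).Ecst k
          + ((piecesAC 𝔎 X 𝔖 k).logσ₀ + (piecesAC 𝔎 X 𝔖 k).dg * Real.log ((towerOfAC 𝔎 X 𝔖).g k)) * (piecesAC 𝔎 X 𝔖 k).starB (Hist.triv S.P (k + 1))
          + (piecesAC 𝔎 X 𝔖 k).logZU (Hist.triv S.P (k + 1)) V + (piecesAC 𝔎 X 𝔖 k).Pold (Hist.triv S.P (k + 1)) V
          + (towerOfAC 𝔎 X 𝔖).Zterm k ((piecesAC 𝔎 X 𝔖 k).proj (Hist.triv S.P (k + 1))) + (towerOfAC 𝔎 X 𝔖).Rm k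
          + (piecesAC 𝔎 X 𝔖 k).logFl (Hist.triv S.P (k + 1)) V))
    (h57 : Fibre57LowOnAC 𝔎 X 𝔖 lo k) :
    ∀ᵐ U ∂(fieldMeasure S.P k G), (X.av k).avg U ∈ lo (k + 1) → PlaqSmall (eps1Of S 𝔎.carrier k) U → U ∈ lo k := by
  classical
  have hAC : AvgAC (X.av k).avg := X.av_ac k
  have havm : Measurable (X.av k).avg := hAC.measurable
  -- the common core exponent `e₃ = B` and the constant `δ`
  set e₃ : GaugeField S.P k G → ℝ := fun U => -((towerOfAC 𝔎 X 𝔖).mainT k (Hist.triv S.P k) U) + (towerOfAC 𝔎 X 𝔖).Pint k (Hist.triv S.P k) U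
      - (towerOfAC 𝔎 X 𝔖).Ecst k - (towerOfAC 𝔎 X 𝔖).Rm k with he₃
  set δ : ℝ := (towerOfAC 𝔎 X 𝔖).Zterm k (Hist.triv S.P k) + 2 * (towerOfAC 𝔎 X 𝔖).Rm k with hδ
  set χB : GaugeField S.P k G → ℝ := chiB 𝔎.carrier.M₁ (rcolOf S 𝔎.carrier) (eps1Of S 𝔎.carrier) k (Hist.triv S.P (k + 1)) with hχB
  set φ : GaugeField S.P k G → ℝ := (lo k).indicator (fun _ => (1 : ℝ)) with hφ
  set F₁ : GaugeField S.P k G → ℝ := fun U => χB U * Real.exp (e₃ U + δ) with hF₁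
  set F₃ : GaugeField S.P k G → ℝ := fun U => φ U * Real.exp (e₃ U) with hF₃
  set f : GaugeField S.P (k + 1) G → ℝ := (lo (k + 1)).indicator (fun _ => (1 : ℝ)) with hf
  set E₄ : GaugeField S.P (k + 1) G → ℝ := fun W => -((towerOfAC 𝔎 X 𝔖).mainT (k + 1) (Hist.triv S.P (k + 1)) W) - (towerOfAC 𝔎 X 𝔖).Ecst k
      + ((piecesAC 𝔎 X 𝔖 k).logσ₀ + (piecesAC 𝔎 X 𝔖 k).dg * Real.log ((towerOfAC 𝔎 X 𝔖).g k)) * (piecesAC 𝔎 X 𝔖 k).starB (Hist.triv S.P (k + 1))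
      + (piecesAC 𝔎 X 𝔖 k).logZU (Hist.triv S.P (k + 1)) W + (piecesAC 𝔎 X 𝔖 k).Pold (Hist.triv S.P (k + 1)) W
      - (towerOfAC 𝔎 X 𝔖).Rm k + (piecesAC 𝔎 X 𝔖 k).logFl (Hist.triv S.P (k + 1)) W with hE₄
  have hPproj : (piecesAC 𝔎 X 𝔖 k).proj (Hist.triv S.P (k + 1)) = Hist.triv S.P k := (piecesAC 𝔎 X 𝔖 k).proj_triv
  -- (i) the two rows, rewritten on `F₁`, `F₃`, `E₄`, `δ`
  have hL55 : (fun U => χB U *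
      Real.exp (-((towerOfAC 𝔎 X 𝔖).mainT k (Hist.triv S.P k) U) + (towerOfAC 𝔎 X 𝔖).Pint k (Hist.triv S.P k) U - (towerOfAC 𝔎 X 𝔖).Ecst k
        + (towerOfAC 𝔎 X 𝔖).Zterm k (Hist.triv S.P k) + (towerOfAC 𝔎 X 𝔖).Rm k)) = F₁ := by
    funext U; rw [hF₁]; simp only; congr 1; rw [he₃, hδ]; ring_nf
  have h55' : ∀ᵐ W ∂(fieldMeasure S.P (k + 1) G), rnTransport (X.av k).avg F₁ W ≤ Real.exp (E₄ W + δ) := by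
    have h := h55
    rw [hL55] at h
    filter_upwards [h] with W hW
    refine hW.trans_eq ?_
    congr 1
    simp only [hE₄, hδ, hPproj]; ring_nf
  have hL57 : (fun U => (lo k).indicator (fun _ => (1 : ℝ)) U *
      Real.exp (-((towerOfAC 𝔎 X 𝔖).mainT k (Hist.triv S.P k) U) + (towerOfAC 𝔎 X 𝔖).Pint k (Hist.triv S.P k) U
        - (towerOfAC 𝔎 X 𝔖).Ecst k - (towerOfAC 𝔎 X 𝔖).Rm k)) = F₃ := by
    funext U; rw [hF₃]
  have h57' : ∀ᵐ W ∂(fieldMeasure S.P (k + 1) G), f W * Real.exp (E₄ W) ≤ rnTransport (X.av k).avg F₃ W := by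
    have h := h57
    unfold Fibre57LowOnAC at h
    rw [hL57] at h
    filter_upwards [h] with W hW
    refine le_of_eq_of_le ?_ hW
    rw [hf, hE₄]
  -- (ii) integrability of the two integrands
  have hmain : ∀ U, (towerOfAC 𝔎 X 𝔖).mainT k (Hist.triv S.P k) U = (S.gk k)⁻¹ ^ 2 * S.actionEta k (X.UkH k (Hist.triv S.P k) U) := fun _ => rfl
  have hPt : ∀ U, (towerOfAC 𝔎 X 𝔖).Pint k (Hist.triv S.P k) U = (inputOfAC 𝔎 X 𝔖).Pint k (Hist.triv S.P k) U := fun _ => rfl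
  have he₃m : Measurable e₃ := by
    rw [he₃]; simp_rw [hmain, hPt]
    exact (((measurable_const.mul ((Bound55Std.measurable_actionEta (S := S) k).comp hU)).neg.add hPm).sub measurable_const).sub
      measurable_const
  have he₃b : ∀ U, e₃ U ≤ cP - (towerOfAC 𝔎 X 𝔖).Ecst k - (towerOfAC 𝔎 X 𝔖).Rm k := fun U => by
    have h0 : 0 ≤ (towerOfAC 𝔎 X 𝔖).mainT k (Hist.triv S.P k) U := by
      rw [hmain]; exact mul_nonneg (sq_nonneg _) (Bound55Std.actionEta_nonneg (S := S) k _)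
    have h1 := hPb U
    rw [he₃]; simp only; rw [hPt]; linarith
  have hφm : Measurable φ := measurable_const.indicator hlom
  have hφ0 : ∀ U, 0 ≤ φ U := fun U => Set.indicator_nonneg (fun _ _ => zero_le_one) U
  have hφ1 : ∀ U, φ U ≤ 1 := fun U => Set.indicator_le_self' (fun _ _ => zero_le_one) U
  have hF₃i : Integrable F₃ (fieldMeasure S.P k G) :=
    Summit.QuantumFields.Balaban3D.Proofs.Transport48.integrable_weight_mul_exp hφm hφ0 hφ1 he₃m
      (c := cP - (towerOfAC 𝔎 X 𝔖).Ecst k - (towerOfAC 𝔎 X 𝔖).Rm k) he₃b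
  have hF₁i : Integrable F₁ (fieldMeasure S.P k G) :=
    Summit.QuantumFields.Balaban3D.Proofs.Transport48.integrable_weight_mul_exp (measurable_chiB _ _ _ k _)
      (chiB_nonneg _ _ _ k _) (chiB_le_one _ _ _ k _)
      (he₃m.add measurable_const) (c := cP - (towerOfAC 𝔎 X 𝔖).Ecst k - (towerOfAC 𝔎 X 𝔖).Rm k + δ) (fun U => by have := he₃b U; linarith)
  -- (iii) the test function `𝟙[lo (k+1)]`: measurable, {0,1}-valued
  have hfm : Measurable f := measurable_const.indicator hlom'
  have hf0 : ∀ W, 0 ≤ f W := fun W => Set.indicator_nonneg (fun _ _ => zero_le_one) W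
  have hf1 : ∀ W, f W ≤ 1 := fun W => Set.indicator_le_self' (fun _ _ => zero_le_one) W
  have hfC : ∃ C : ℝ, ∀ W, |f W| ≤ C := ⟨1, fun W => by rw [abs_of_nonneg (hf0 W)]; exact hf1 W⟩
  -- (iv) the squeeze, a.e. on the coarse fields: `f · T F₁ ≤ e^δ · (T F₃ · f)`
  have hsq : ∀ᵐ W ∂(fieldMeasure S.P (k + 1) G),
      rnTransport (X.av k).avg F₁ W * f W ≤ Real.exp δ * (rnTransport (X.av k).avg F₃ W * f W) := by
    filter_upwards [h55', h57'] with W h1 h2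
    by_cases hW : W ∈ lo (k + 1)
    · have hfW : f W = 1 := by rw [hf, Set.indicator_of_mem hW]
      rw [hfW, mul_one, mul_one]
      rw [hfW, one_mul] at h2
      calc rnTransport (X.av k).avg F₁ W ≤ Real.exp (E₄ W + δ) := h1
        _ = Real.exp δ * Real.exp (E₄ W) := by rw [Real.exp_add, mul_comm]
        _ ≤ Real.exp δ * rnTransport (X.av k).avg F₃ W := mul_le_mul_of_nonneg_left h2 (Real.exp_pos _).le
    · have hfW : f W = 0 := by rw [hf, Set.indicator_of_notMem hW]
      rw [hfW]; simp
  -- (v) integrate and push through `T` (the IsRT identity with test function `f`)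
  have hI₁ : Integrable (fun W => rnTransport (X.av k).avg F₁ W * f W) (fieldMeasure S.P (k + 1) G) :=
    Summit.QuantumFields.Balaban3D.Proofs.RTAlgebra.integrable_mul_test (integrable_rnTransport (X.av k).avg F₁ hF₁i) hfm (C := 1)
      (fun W => by rw [abs_of_nonneg (hf0 W)]; exact hf1 W)
  have hI₃ : Integrable (fun W => rnTransport (X.av k).avg F₃ W * f W) (fieldMeasure S.P (k + 1) G) :=
    Summit.QuantumFields.Balaban3D.Proofs.RTAlgebra.integrable_mul_test (integrable_rnTransport (X.av k).avg F₃ hF₃i) hfm (C := 1)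
      (fun W => by rw [abs_of_nonneg (hf0 W)]; exact hf1 W)
  have hint_le : ∫ W, rnTransport (X.av k).avg F₁ W * f W ∂(fieldMeasure S.P (k + 1) G) ≤
      Real.exp δ * ∫ W, rnTransport (X.av k).avg F₃ W * f W ∂(fieldMeasure S.P (k + 1) G) := by
    rw [← integral_const_mul]
    exact integral_mono_ae hI₁ (hI₃.const_mul _) hsq
  have hRT₁ := isRT_rnTransport_of_ac hAC F₁ hF₁i f hfm hfC
  have hRT₃ := isRT_rnTransport_of_ac hAC F₃ hF₃i f hfm hfC
  rw [hRT₁, hRT₃, ← integral_const_mul] at hint_le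
  -- (vi) the difference has a non-negative integrand with non-positive integral
  set D : GaugeField S.P k G → ℝ := fun U => (χB U - φ U) * Real.exp (e₃ U + δ) * f ((X.av k).avg U) with hD
  have hχB01 : ∀ U, χB U = (if PlaqSmall (eps1Of S 𝔎.carrier k) U then 1 else 0) := fun U =>
    Summit.QuantumFields.Balaban3D.Proofs.FibreClash.chiB_triv_eq (S := S) k 𝔎.carrier.M₁ (rcolOf S 𝔎.carrier) (eps1Of S 𝔎.carrier) U
  have hmono : ∀ U, φ U ≤ χB U := fun U => by
    by_cases hUlo : U ∈ lo k
    · have hsm : PlaqSmall (eps1Of S 𝔎.carrier k) U := hlow hUlo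
      rw [hφ, Set.indicator_of_mem hUlo, hχB01, if_pos hsm]
    · rw [hφ, Set.indicator_of_notMem hUlo]; exact chiB_nonneg _ _ _ k _ U
  have hD0 : ∀ U, 0 ≤ D U := fun U =>
    mul_nonneg (mul_nonneg (sub_nonneg.mpr (hmono U)) (Real.exp_pos _).le) (hf0 _)
  have hIF₁ : Integrable (fun U => F₁ U * f ((X.av k).avg U)) (fieldMeasure S.P k G) :=
    Summit.QuantumFields.Balaban3D.Proofs.RTAlgebra.integrable_mul_test_comp hF₁i havm hfm (C := 1)
      (fun W => by rw [abs_of_nonneg (hf0 W)]; exact hf1 W)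
  have hIF₃ : Integrable (fun U => F₃ U * f ((X.av k).avg U)) (fieldMeasure S.P k G) :=
    Summit.QuantumFields.Balaban3D.Proofs.RTAlgebra.integrable_mul_test_comp hF₃i havm hfm (C := 1)
      (fun W => by rw [abs_of_nonneg (hf0 W)]; exact hf1 W)
  have hDeq : D = fun U => F₁ U * f ((X.av k).avg U) - Real.exp δ * (F₃ U * f ((X.av k).avg U)) := by
    funext U; rw [hD, hF₁, hF₃]; simp only; rw [Real.exp_add]; ring
  have hDi : Integrable D (fieldMeasure S.P k G) := by rw [hDeq]; exact hIF₁.sub (hIF₃.const_mul _)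
  have hDint : ∫ U, D U ∂(fieldMeasure S.P k G) ≤ 0 := by
    have : ∫ U, D U ∂(fieldMeasure S.P k G) = ∫ U, F₁ U * f ((X.av k).avg U) ∂(fieldMeasure S.P k G)
        - ∫ U, Real.exp δ * (F₃ U * f ((X.av k).avg U)) ∂(fieldMeasure S.P k G) := by
      rw [← integral_sub hIF₁ (hIF₃.const_mul _), hDeq]
    rw [this]; linarith
  have hDae : D =ᵐ[fieldMeasure S.P k G] 0 :=
    (integral_eq_zero_iff_of_nonneg_ae (Filter.Eventually.of_forall hD0) hDi).mp
      (le_antisymm hDint (integral_nonneg hD0))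
  -- (vii) read off the a.e. implication
  filter_upwards [hDae] with U hDU hS hsmall
  have hfU : f ((X.av k).avg U) = 1 := by rw [hf, Set.indicator_of_mem hS]
  have hχBU : χB U = 1 := by rw [hχB01, if_pos hsmall]
  by_contra hns
  have hφU : φ U = 0 := by rw [hφ, Set.indicator_of_notMem hns]
  have hDU' : D U = Real.exp (e₃ U + δ) := by rw [hD]; simp only; rw [hχBU, hφU, hfU]; ring
  have : D U = 0 := hDU
  rw [hDU'] at this
  exact (Real.exp_pos _).ne' this

/-! ## §2 From the windowed (55)-row itself, and the print-family reading: a.e.-`hdom` at window constant ONE -/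

/-- **THE SQUEEZE FROM THE REGISTERED ROW TEXTS**: `PinnedStep.Fibre55WinAC 𝔎 X 𝔖 win k (Hist.triv _ (k+1))` (R3D-01 at the trivial new history; standing range
`k ≤ m + K`) with the window covering the small-field factor (`hsupp`, for print's (40) windows `AlphaInputsT3AC.wtP_admWindowT3_triv_eq_one`) and
`PinnedStep.Fibre57LowOnAC 𝔎 X 𝔖 lo k` (R3D-02χ), `lo k` inside the (4)-window ⇒ for dU-a.e. `U`: `Ū ∈ lo (k+1) → |U(∂p) − 1| < ε₁(k) ∀p → U ∈ lo k`. [folklore] -/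
theorem ae_mem_lo_of_fibre55Win_triv_of_fibre57LowOn (win : (k : ℕ) → Hist S.P (k + 1) → Set (GaugeField S.P (k + 1) G))
    (lo : (k : ℕ) → Set (GaugeField S.P k G)) (k : ℕ) (hk : k ≤ S.P.m + S.P.K)
    (hlom : MeasurableSet (lo k)) (hlom' : MeasurableSet (lo (k + 1)))
    (hlow : lo k ⊆ {U | PlaqSmall (eps1Of S 𝔎.carrier k) U})
    (hU : Measurable (X.UkH k (Hist.triv S.P k))) (hPm : Measurable ((inputOfAC 𝔎 X 𝔖).Pint k (Hist.triv S.P k)))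
    (cP : ℝ) (hPb : ∀ U, (inputOfAC 𝔎 X 𝔖).Pint k (Hist.triv S.P k) U ≤ cP)
    (hrow : Fibre55WinAC 𝔎 X 𝔖 win k (Hist.triv S.P (k + 1)))
    (hsupp : ∀ U : GaugeField S.P k G,
      chiB 𝔎.carrier.M₁ (rcolOf S 𝔎.carrier) (eps1Of S 𝔎.carrier) k (Hist.triv S.P (k + 1)) U ≠ 0 → wtP 𝔎 X win k (Hist.triv S.P k) U = 1)
    (h57 : Fibre57LowOnAC 𝔎 X 𝔖 lo k) :
    ∀ᵐ U ∂(fieldMeasure S.P k G), (X.av k).avg U ∈ lo (k + 1) → PlaqSmall (eps1Of S 𝔎.carrier k) U → U ∈ lo k :=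
  ae_mem_lo_of_fibre55Triv_of_fibre57LowOn 𝔎 X 𝔖 lo k hlom hlom' hlow hU hPm cP hPb
    (LogComparisonRepAtHeights.fibre55Triv_of_fibre55WinAC 𝔎 X 𝔖 win k hk hrow hsupp) h57

/-- **a.e.-`hdom` AT WINDOW CONSTANT ONE IS A COROLLARY OF THE TWO χ-ROWS.**  At print's family `lo = PinnedStep.loPrintAC 𝔎 X` (the registered lower row of
`StepDataV3ChiAC`, `…v3DataSchemaChi` :159): the mass-free trivial-history (55)-row and the lower row on `loPrintAC` (both measurable families) force, for `dU`-a.e. `U`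
whose average lies in `loPrintAC (k+1)`, «`|U(∂p) − 1| < ε₁(k) ∀p ⇒ U ∈ chiMinAC 𝔎 X 1 k`» — print's minimiser window `|U_k(U)(∂p) − 1| < ε₁(k)η²` at constant ONE, i.e. the
displayed (E2) letter `hdom` of the (α)-#23 chain almost everywhere on the charged region.  ([Balaban1985Variational] Thm 1 (8) prints the constant `2L²B₃`; nothing here
proves or refutes the letter — the theorem says any JOINT supplier of the two rows supplies it a.e.) [folklore] -/
theorem ae_hdom_one_of_rows (k : ℕ)
    (hlom : MeasurableSet (loPrintAC 𝔎 X k)) (hlom' : MeasurableSet (loPrintAC 𝔎 X (k + 1)))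
    (hU : Measurable (X.UkH k (Hist.triv S.P k))) (hPm : Measurable ((inputOfAC 𝔎 X 𝔖).Pint k (Hist.triv S.P k)))
    (cP : ℝ) (hPb : ∀ U, (inputOfAC 𝔎 X 𝔖).Pint k (Hist.triv S.P k) U ≤ cP)
    (h55 : (rnTransport (X.av k).avg (fun U =>
        chiB 𝔎.carrier.M₁ (rcolOf S 𝔎.carrier) (eps1Of S 𝔎.carrier) k (Hist.triv S.P (k + 1)) U *
          Real.exp (-((towerOfAC 𝔎 X 𝔖).mainT k (Hist.triv S.P k) U) + (towerOfAC 𝔎 X 𝔖).Pint k (Hist.triv S.P k) U - (towerOfAC 𝔎 X 𝔖).Ecst k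
            + (towerOfAC 𝔎 X 𝔖).Zterm k (Hist.triv S.P k) + (towerOfAC 𝔎 X 𝔖).Rm k)))
      ≤ᵐ[fieldMeasure S.P (k + 1) G] fun V =>
        Real.exp (-((towerOfAC 𝔎 X 𝔖).mainT (k + 1) (Hist.triv S.P (k + 1)) V) - (towerOfAC 𝔎 X 𝔖).Ecst k
          + ((piecesAC 𝔎 X 𝔖 k).logσ₀ + (piecesAC 𝔎 X 𝔖 k).dg * Real.log ((towerOfAC 𝔎 X 𝔖).g k)) * (piecesAC 𝔎 X 𝔖 k).starB (Hist.triv S.P (k + 1))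
          + (piecesAC 𝔎 X 𝔖 k).logZU (Hist.triv S.P (k + 1)) V + (piecesAC 𝔎 X 𝔖 k).Pold (Hist.triv S.P (k + 1)) V
          + (towerOfAC 𝔎 X 𝔖).Zterm k ((piecesAC 𝔎 X 𝔖 k).proj (Hist.triv S.P (k + 1))) + (towerOfAC 𝔎 X 𝔖).Rm k
          + (piecesAC 𝔎 X 𝔖 k).logFl (Hist.triv S.P (k + 1)) V))
    (h57 : Fibre57LowOnAC 𝔎 X 𝔖 (loPrintAC 𝔎 X) k) :
    ∀ᵐ U ∂(fieldMeasure S.P k G), (X.av k).avg U ∈ loPrintAC 𝔎 X (k + 1) →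
      PlaqSmall (eps1Of S 𝔎.carrier k) U → U ∈ chiMinAC 𝔎 X 1 k := by
  filter_upwards [ae_mem_lo_of_fibre55Triv_of_fibre57LowOn 𝔎 X 𝔖 (loPrintAC 𝔎 X) k hlom hlom' (loPrintAC_subset_window 𝔎 X k)
    hU hPm cP hPb h55 h57] with U hUimp hS hsmall
  exact (hUimp hS hsmall).2

/-- **THE SAME IN THE LETTER'S OWN SHAPE**: the displayed (E2) binder reads `∀ U, χB_k(triv′)(U) ≠ 0 → U ∈ PinnedStep.loPrintAC 𝔠.lane X k` (e.g.
✓`…v3StepLowPrintOrbit.fibre57LowOnAC_T3_loPrintAC_of_le_gamma_of_orbit` :140); from the two χ-rows it holds for `dU`-a.e. `U` over `loPrintAC (k+1)`. [folklore] -/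
theorem ae_hdom_letter_of_rows (k : ℕ)
    (hlom : MeasurableSet (loPrintAC 𝔎 X k)) (hlom' : MeasurableSet (loPrintAC 𝔎 X (k + 1)))
    (hU : Measurable (X.UkH k (Hist.triv S.P k))) (hPm : Measurable ((inputOfAC 𝔎 X 𝔖).Pint k (Hist.triv S.P k)))
    (cP : ℝ) (hPb : ∀ U, (inputOfAC 𝔎 X 𝔖).Pint k (Hist.triv S.P k) U ≤ cP)
    (h55 : (rnTransport (X.av k).avg (fun U =>
        chiB 𝔎.carrier.M₁ (rcolOf S 𝔎.carrier) (eps1Of S 𝔎.carrier) k (Hist.triv S.P (k + 1)) U *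
          Real.exp (-((towerOfAC 𝔎 X 𝔖).mainT k (Hist.triv S.P k) U) + (towerOfAC 𝔎 X 𝔖).Pint k (Hist.triv S.P k) U - (towerOfAC 𝔎 X 𝔖).Ecst k
            + (towerOfAC 𝔎 X 𝔖).Zterm k (Hist.triv S.P k) + (towerOfAC 𝔎 X 𝔖).Rm k)))
      ≤ᵐ[fieldMeasure S.P (k + 1) G] fun V =>
        Real.exp (-((towerOfAC 𝔎 X 𝔖).mainT (k + 1) (Hist.triv S.P (k + 1)) V) - (towerOfAC 𝔎 X 𝔖).Ecst k
          + ((piecesAC 𝔎 X 𝔖 k).logσ₀ + (piecesAC 𝔎 X 𝔖 k).dg * Real.log ((towerOfAC 𝔎 X 𝔖).g k)) * (piecesAC 𝔎 X 𝔖 k).starB (Hist.triv S.P (k + 1))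
          + (piecesAC 𝔎 X 𝔖 k).logZU (Hist.triv S.P (k + 1)) V + (piecesAC 𝔎 X 𝔖 k).Pold (Hist.triv S.P (k + 1)) V
          + (towerOfAC 𝔎 X 𝔖).Zterm k ((piecesAC 𝔎 X 𝔖 k).proj (Hist.triv S.P (k + 1))) + (towerOfAC 𝔎 X 𝔖).Rm k
          + (piecesAC 𝔎 X 𝔖 k).logFl (Hist.triv S.P (k + 1)) V))
    (h57 : Fibre57LowOnAC 𝔎 X 𝔖 (loPrintAC 𝔎 X) k) :
    ∀ᵐ U ∂(fieldMeasure S.P k G), (X.av k).avg U ∈ loPrintAC 𝔎 X (k + 1) →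
      chiB 𝔎.carrier.M₁ (rcolOf S 𝔎.carrier) (eps1Of S 𝔎.carrier) k (Hist.triv S.P (k + 1)) U ≠ 0 → U ∈ loPrintAC 𝔎 X k := by
  classical
  filter_upwards [ae_mem_lo_of_fibre55Triv_of_fibre57LowOn 𝔎 X 𝔖 (loPrintAC 𝔎 X) k hlom hlom' (loPrintAC_subset_window 𝔎 X k)
    hU hPm cP hPb h55 h57] with U hUimp hS hχ
  have hsmall : PlaqSmall (eps1Of S 𝔎.carrier k) U := by
    by_contra hns
    apply hχ
    rw [Summit.QuantumFields.Balaban3D.Proofs.FibreClash.chiB_triv_eq (S := S) k 𝔎.carrier.M₁ (rcolOf S 𝔎.carrier) (eps1Of S 𝔎.carrier) U,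
      if_neg hns]
  exact hUimp hS hsmall

end Summit.QuantumFields.YangMills.Theorems.PinnedStepChiClash

end
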